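import Summits.QuantumAdvantage.AdviceFreeQNC0.RingHardOdd
import Summits.QuantumAdvantage.AdviceFreeQNC0.RingCanonical
import Summits.QuantumAdvantage.AdviceFreeQNC0.KernelFibration
import Summits.QuantumAdvantage.AdviceFreeQNC0.HardcoreToggle
import HarnessLib

/-!
# Cell qa-qnc0, frame second moment (ROUND-21 §3): (HC-λ) the PARITY BIAS OF THE KERNEL LINE — planner qa-qnc0-p1 g22,
`Sketch22.lean` §2, statements VERBATIM

Support for crux `RingDenseResidualLt3` (stmt-QuantumAdvantage-22907), route `DWalkThree`, rung candidate
`RingFrameAffineLt3` (R-frame).  For every non-empty set `S` of ring positions the sign `(−1)^{|supp J(x) ∩ S|}` of the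
kernel line `J(x) = Fib19.kline x` has average at most `λ < 1` in absolute value over the odd class, uniformly in `S` and
`n`: this `λ` is the only strategy-independent constant of the frame second moment `E_J bias_J² ≤ 2/3 + λ/3 + o(1)`.

PROVED here (0 sorry):
* `kernelLineParityBiasOfToggle : KernelLineParityBiasOfToggle` — from the tree's toggle lemma `Fib19.HardcoreToggle`
  (pick `u ∈ S`, `p = u ± 2`, `p' = u ± 4` at pairwise cyclic distance `≥ 2`, `n ≥ max(n₁, 8)`): both parities of
  `|supp J ∩ S|` have `≥ c₁·2^{n−1}` odd patterns, so `|Σ_{x odd} (−1)^{|supp J ∩ S|}| ≤ (1 − 2c₁)·2^{n−1}`;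
* `kernelLineParityBias : KernelLineParityBias` — unconditional, by `Fib19.hardcoreToggle`.

WHAT THIS IS NOT: no value of `λ` (the kit's `1/3`), no transfer-matrix proof; nothing about the crux.
-/

namespace Summit.QuantumAdvantage.AdviceFreeQNC0

open Finset Literature.Computability.QuantumComplexity Literature.Computability.QuantumComplexity.RingHLF
open Literature.Computability.MetaComplexity

namespace AffBells22

/-! ## Statements (planner qa-qnc0-p1 g22, Sketch22.lean §2 — VERBATIM) -/

/-- **(HC-λ) PARITY BIAS OF THE KERNEL LINE** (support): `sup_{S ≠ ∅} |E_{x odd}(−1)^{|supp J(x) ∩ S|}| ≤ λ < 1` uniformly.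
Two proofs: (i) the tree's `Fib19.hardcoreToggle` gives both parities mass `≥ c₁·2^{n−1}` (pick `u ∈ S`, `p = u+2`, `p' = u+4`),
so `λ = 1 − 2c₁`; (ii) transfer matrices `T = [[1,2],[1,0]]`, `T̃ = [[−1,2],[−1,0]]` (sign on "next site active"), and in the
eigenbasis of `T` one has `‖T̃/2‖₂ = 0.795 < 1 = ‖T/2‖₂`.  Kit j300177 (exact, Walsh–Hadamard of the law of `J`):
`λ_11 = .33398`, `λ_13 = .33350`, `λ_15 = .33337`, attained at `|S| ∈ {1,2,3}`; conjecture `λ = 1/3 + O(2^{−N})`. -/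
def KernelLineParityBias : Prop :=
  open scoped Classical in
  ∃ lam : ℝ, lam < 1 ∧ ∃ n₀ : ℕ, ∀ n ≥ n₀, ∀ S : Finset (Fin n), S.Nonempty →
    |∑ x ∈ (univ.filter fun x : Fin n → Bool => Fib19.IsOdd x),
        (-1 : ℝ) ^ (S.filter fun k => Fib19.kline x k = true).card| ≤ lam * (2 : ℝ) ^ (n - 1)

/-- (HC-λ) from the landed toggle lemma — a short bookkeeping proof (both parity classes of `|supp J ∩ S|` have `≥ c₁·2^{n−1}`
odd patterns once `n ≥ max(n₁, 6)`, dropping the cylinder condition). -/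
def KernelLineParityBiasOfToggle : Prop := Fib19.HardcoreToggle → KernelLineParityBias

/-! ## Proof -/

/-- `(k + n) % n = k` for `k < n`. -/
theorem add_mod_self_of_lt {k n : ℕ} (h : k < n) : (k + n) % n = k := by
  rw [Nat.add_mod_right, Nat.mod_eq_of_lt h]

/-- `(−1)^m` as a parity indicator. -/
theorem neg_one_pow_eq_ite (m : ℕ) : (-1 : ℝ) ^ m = if m % 2 = 0 then 1 else -1 := by
  rcases Nat.even_or_odd m with h | h
  · rw [h.neg_one_pow, if_pos (Nat.even_iff.mp h)]
  · rw [h.neg_one_pow, if_neg (by rw [Nat.odd_iff.mp h]; decide)]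

/-- **(HC-λ) from the toggle lemma, PROVED** (`λ = 1 − 2c₁`, `n₀ = max(n₁, 8)`). -/
theorem kernelLineParityBiasOfToggle : KernelLineParityBiasOfToggle := by
  intro hT
  obtain ⟨c₁, hc₁, n₁, hn₁⟩ := hT
  refine ⟨1 - 2 * c₁, by linarith, max n₁ 8, fun n hn S hS => ?_⟩
  classical
  have hn8 : 8 ≤ n := le_trans (le_max_right _ _) hn
  have hnn₁ : n₁ ≤ n := le_trans (le_max_left _ _) hn
  obtain ⟨u, hu⟩ := hS
  -- two positions at pairwise cyclic distance ≥ 2 from each other and from `u`, without wrap-around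
  obtain ⟨p, p', hpp'1, hpp'2, hup1, hup2, hup'1, hup'2⟩ : ∃ p p' : Fin n,
      2 ≤ (p'.val + n - p.val) % n ∧ 2 ≤ (p.val + n - p'.val) % n ∧
      2 ≤ (u.val + n - p.val) % n ∧ 2 ≤ (p.val + n - u.val) % n ∧
      2 ≤ (u.val + n - p'.val) % n ∧ 2 ≤ (p'.val + n - u.val) % n := by
    by_cases h4 : u.val + 4 < n
    · refine ⟨⟨u.val + 2, by omega⟩, ⟨u.val + 4, h4⟩, ?_, ?_, ?_, ?_, ?_, ?_⟩ <;> dsimp only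
      · rw [show u.val + 4 + n - (u.val + 2) = 2 + n by omega, add_mod_self_of_lt (by omega)]
      · rw [show u.val + 2 + n - (u.val + 4) = n - 2 by omega, Nat.mod_eq_of_lt (by omega)]; omega
      · rw [show u.val + n - (u.val + 2) = n - 2 by omega, Nat.mod_eq_of_lt (by omega)]; omega
      · rw [show u.val + 2 + n - u.val = 2 + n by omega, add_mod_self_of_lt (by omega)]
      · rw [show u.val + n - (u.val + 4) = n - 4 by omega, Nat.mod_eq_of_lt (by omega)]; omega
      · rw [show u.val + 4 + n - u.val = 4 + n by omega, add_mod_self_of_lt (by omega)]; omega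
    · have hu4 : 4 ≤ u.val := by omega
      have hun : u.val < n := u.2
      refine ⟨⟨u.val - 2, by omega⟩, ⟨u.val - 4, by omega⟩, ?_, ?_, ?_, ?_, ?_, ?_⟩ <;> dsimp only
      · rw [show u.val - 4 + n - (u.val - 2) = n - 2 by omega, Nat.mod_eq_of_lt (by omega)]; omega
      · rw [show u.val - 2 + n - (u.val - 4) = 2 + n by omega, add_mod_self_of_lt (by omega)]
      · rw [show u.val + n - (u.val - 2) = 2 + n by omega, add_mod_self_of_lt (by omega)]
      · rw [show u.val - 2 + n - u.val = n - 2 by omega, Nat.mod_eq_of_lt (by omega)]; omega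
      · rw [show u.val + n - (u.val - 4) = 4 + n by omega, add_mod_self_of_lt (by omega)]; omega
      · rw [show u.val - 4 + n - u.val = n - 4 by omega, Nat.mod_eq_of_lt (by omega)]; omega
  -- the two parity classes of `|supp J ∩ S|` on the odd class
  set O : Finset (Fin n → Bool) := univ.filter fun x : Fin n → Bool => Fib19.IsOdd x with hO
  set par : (Fin n → Bool) → ℕ := fun x => (S.filter fun k => Fib19.kline x k = true).card with hpar
  have hlow : ∀ b : ℕ, b < 2 →
      c₁ * (2 : ℝ) ^ (n - 1) ≤ ((O.filter fun x => par x % 2 = b).card : ℝ) := by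
    intro b hb
    refine (hn₁ n hnn₁ p p' u S hpp'1 hpp'2 hup1 hup2 hup'1 hup'2 hu b hb).trans ?_
    have hsub : (univ.filter fun x : Fin n → Bool => OddZeros x ∧ Fib19.kline x p = false ∧
        Fib19.kline x p' = false ∧ (S.filter fun k => Fib19.kline x k = true).card % 2 = b)
        ⊆ O.filter fun x => par x % 2 = b := by
      intro x hx
      rw [mem_filter] at hx
      rw [mem_filter, hO, mem_filter]
      exact ⟨⟨mem_univ _, (Fib19.isOdd_iff_oddZeros x).mpr hx.2.1⟩, hx.2.2.2.2⟩
    exact_mod_cast card_le_card hsub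
  have hOcard : (O.card : ℝ) = (2 : ℝ) ^ (n - 1) := by
    have h := Fib19.card_isOdd (n := n) (by omega)
    have hO' : O = univ.filter fun x : Fin n → Bool => Fib19.IsOdd x := by
      rw [hO]
    rw [hO', h]
    push_cast
    ring
  -- the signed sum is `#even − #odd`
  have hsum : ∑ x ∈ O, (-1 : ℝ) ^ par x
      = ((O.filter fun x => par x % 2 = 0).card : ℝ) - ((O.filter fun x => par x % 2 = 1).card : ℝ) := by
    simp_rw [neg_one_pow_eq_ite]
    rw [Finset.sum_ite, sum_const, sum_const, nsmul_eq_mul, nsmul_eq_mul, mul_one, mul_neg_one, ← sub_eq_add_neg]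
    congr 3
    exact filter_congr fun x _ => by omega
  have hsplit : ((O.filter fun x => par x % 2 = 0).card : ℝ) + ((O.filter fun x => par x % 2 = 1).card : ℝ)
      = (2 : ℝ) ^ (n - 1) := by
    rw [← hOcard]
    have h := Finset.card_filter_add_card_filter_not (s := O) (fun x => par x % 2 = 0)
    have h1 : (O.filter fun x => ¬ par x % 2 = 0) = O.filter fun x => par x % 2 = 1 :=
      filter_congr fun x _ => by omega
    rw [h1] at h
    exact_mod_cast h
  have h0 := hlow 0 (by norm_num)
  have h1 := hlow 1 (by norm_num)
  show |∑ x ∈ O, (-1 : ℝ) ^ par x| ≤ (1 - 2 * c₁) * (2 : ℝ) ^ (n - 1)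
  rw [hsum, abs_le]
  constructor <;> linarith

/-- **(HC-λ) PROVED, unconditionally** (the toggle lemma is the tree theorem `Fib19.hardcoreToggle`). -/
theorem kernelLineParityBias : KernelLineParityBias := kernelLineParityBiasOfToggle Fib19.hardcoreToggle

end AffBells22

end Summit.QuantumAdvantage.AdviceFreeQNC0
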